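import Summits.BirchSwinnertonDyer.BirchSwinnertonDyer.Theses.GenusKolyvaginAtTwo
import Summits.BirchSwinnertonDyer.BirchSwinnertonDyer.Theorems.GenusKolyvaginAtTwoCasselsTatePTcRealReadout
import Literature.NumberTheory.EllipticCurves.CasselsTateAlternating
import Literature.NumberTheory.EllipticCurves.BSDShaProofs
import HarnessLib

/-!
# The Cassels–Tate theorem over every number field; route item 19420 `CasselsTatePairingRat` BY NAME

Route `GenusKolyvaginAtTwo`, crux `GenusPrimitiveSupplyAtTwo` (stmt-BirchSwinnertonDyer-22136), child item
stmt-BirchSwinnertonDyer-19420 `CasselsTatePairingRat := WeierstrassCurve.exists_casselsTate_pairing (K := ℚ)`;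
seat `bsd-line-gk2-p1` g13 (LEAD, cell `bsd-f1-sign2`). THEOREMS ONLY (no definition, no named fact, no `sorry`).

The tree's named fact `WeierstrassCurve.exists_casselsTate_pairing (K := K)` (`BSDSha.lean`, bsd.S18) — an alternating
bi-additive pairing `Ш(E/K) × Ш(E/K) → ℚ/ℤ` whose kernel is exactly the divisible part — is DISCHARGED here for EVERY
elliptic curve over EVERY number field `K : Type`, by composing two tree theorems:

* `GenusExact.CasselsTatePTcReal.exists_casselsTate_pairing_of_levelThetaDatum` (gk2-p2 g13): the fact over every number
  field modulo a `LevelThetaDatum W (2^k) e … 2` for every Weil-type pairing `e` on `E[2^{2k}]`, `k > 0` (levelwise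
  assembly of the general-case pairing of THE canonical local invariant maps; Poitou–Tate for `Ш²(K, E[m])` with the
  archimedean terms, `Ш³(K, μ) = 0`, Lemma 6.15; odd levels by `2⟨a,a⟩ = 0`);
* `Literature.NumberTheory.EllipticCurves.levelThetaDatumEven` (gk2-p1 g12): the theta group with level structure at
  `l = 2` for every EVEN level `m` (Morgan–Smith 2021 §5), which needs only `e T T = 1`.

Contents: `WeierstrassCurve.exists_casselsTate_pairing_holds` (the discharge, universe `Type` — the Ш²-cochain bridge
is typed at `Type`), `exists_casselsTate_pairing_numberField` (explicit-`K` form), the unconditional corollaries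
`WeierstrassCurve.isSquare_natCard_sha` / `WeierstrassCurve.isSquare_shaOrder_of_shaFinite` (a finite `Ш(E/K)` has
square order; Silverman X.4.14 "in particular"), and at `K = ℚ` the route item
`casselsTatePairingRat_proof : GenusKolyvaginAtTwo.CasselsTatePairingRat`.

BSD is not proved by any of this.

References: [Cassels1962ArithmeticIV] §1; [MilneADT2006] Ch. I §6 Thm. 6.13 (a)(b); [SilvermanAEC2009] Thm. X.4.14;
[MorganSmith2021CTP] §5 Thm. 5.10.
-/

noncomputable section

-- `Summit.<P>.<Sub>` repeats `BirchSwinnertonDyer` by the tree's layout convention (D-0017)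
set_option linter.dupNamespace false
set_option autoImplicit false

open Literature.NumberTheory.EllipticCurves
open Summit.BirchSwinnertonDyer.BirchSwinnertonDyer.Theorems.GenusExact.CasselsTatePTcReal

/-- **The Cassels–Tate theorem — the named fact `WeierstrassCurve.exists_casselsTate_pairing` DISCHARGED** (Cassels 1962 /
Tate 1963 / Milne ADT I Thm. 6.13 / Silverman X.4.14): for every number field `K` (universe `Type`) and every elliptic
curve `E/K` there is an alternating bi-additive pairing `Ш(E/K) × Ш(E/K) → ℚ/ℤ` whose kernel is exactly the divisible
subgroup. Proof: `exists_casselsTate_pairing_of_levelThetaDatum` fed with the even-level theta datum `levelThetaDatumEven`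
at `m = 2^k`, `k > 0`. Deliberate placement in Mathlib's `WeierstrassCurve` namespace: it is the `_holds` discharge of the
fact declared there (`BSDSha.lean`, bsd.S18).
[cite: Cassels1962ArithmeticIV, §1][cite: Tate1963DualityICM][cite: MilneADT2006, Ch. I §6 Thm. 6.13 (a)(b)]
[cite: SilvermanAEC2009, Thm. X.4.14][cite: MorganSmith2021CTP, §5 Thm. 5.10] -/
theorem _root_.WeierstrassCurve.exists_casselsTate_pairing_holds {K : Type} [Field K] [NumberField K] :
    WeierstrassCurve.exists_casselsTate_pairing (K := K) :=
  exists_casselsTate_pairing_of_levelThetaDatum (K := K)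
    fun W _ k hk _ e hμ hadd₁ hadd₂ _hgal halt _hnd =>
      ⟨levelThetaDatumEven W (2 ^ k) e hμ hadd₁ hadd₂ halt (Nat.even_pow.mpr ⟨even_two, hk.ne'⟩)⟩

/-- **A finite `Ш(E/K)` has square order, unconditionally** (Silverman X.4.14 "in particular" / App. C Cor. 17.2.1;
Milne ADT I.6.26): the tree's `isSquare_card_sha_of_finite_of_casselsTate` with its Cassels–Tate hypothesis discharged
by `exists_casselsTate_pairing_holds`. Deliberate dot-notation extension of Mathlib's `WeierstrassCurve` namespace (as
in `BSDShaProofs.lean`). [cite: SilvermanAEC2009, Thm. X.4.14 and Exercise 10.20] -/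
theorem _root_.WeierstrassCurve.isSquare_natCard_sha {K : Type} [Field K] [NumberField K] (W : WeierstrassCurve K)
    [W.IsElliptic] [Finite W.sha] : IsSquare (Nat.card W.sha) :=
  WeierstrassCurve.isSquare_card_sha_of_finite_of_casselsTate WeierstrassCurve.exists_casselsTate_pairing_holds W

/-- **`shaOrder E/K` is a perfect square when `Ш(E/K)` is finite, unconditionally** (Silverman X.4.14 "in particular"):
the tree's `isSquare_shaOrder_of_casselsTate` with its Cassels–Tate hypothesis discharged. Deliberate dot-notation
extension of Mathlib's `WeierstrassCurve` namespace. [cite: SilvermanAEC2009, Thm. X.4.14] -/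
theorem _root_.WeierstrassCurve.isSquare_shaOrder_of_shaFinite {K : Type} [Field K] [NumberField K]
    (W : WeierstrassCurve K) [W.IsElliptic] (hW : W.ShaFinite) : IsSquare W.shaOrder :=
  WeierstrassCurve.isSquare_shaOrder_of_casselsTate WeierstrassCurve.exists_casselsTate_pairing_holds W hW

namespace Summit.BirchSwinnertonDyer.BirchSwinnertonDyer.Theorems

/-- **The Cassels–Tate theorem over every number field, explicit-`K` form**: for every number field `K : Type`,
`WeierstrassCurve.exists_casselsTate_pairing (K := K)` — every elliptic `E/K` carries an alternating bi-additive pairing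
on `Ш(E/K)` with kernel the divisible subgroup. [cite: Cassels1962ArithmeticIV, §1]
[cite: MilneADT2006, Ch. I §6 Thm. 6.13 (a)(b)][cite: SilvermanAEC2009, Thm. X.4.14] -/
theorem exists_casselsTate_pairing_numberField (K : Type) [Field K] [NumberField K] :
    WeierstrassCurve.exists_casselsTate_pairing (K := K) :=
  WeierstrassCurve.exists_casselsTate_pairing_holds

/-- **Route item stmt-BirchSwinnertonDyer-19420 `CasselsTatePairingRat` BY NAME**: the Cassels–Tate pairing on `Ш(E/ℚ)`
with divisible kernel exists for every elliptic curve over `ℚ` — `exists_casselsTate_pairing_holds (K := ℚ)`.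
[cite: Cassels1962ArithmeticIV, §1][cite: MilneADT2006, Ch. I §6 Thm. 6.13][cite: SilvermanAEC2009, Thm. X.4.14] -/
theorem casselsTatePairingRat_proof :
    Summit.BirchSwinnertonDyer.BirchSwinnertonDyer.Theses.GenusKolyvaginAtTwo.CasselsTatePairingRat := by
  unfold Summit.BirchSwinnertonDyer.BirchSwinnertonDyer.Theses.GenusKolyvaginAtTwo.CasselsTatePairingRat
  exact WeierstrassCurve.exists_casselsTate_pairing_holds

end Summit.BirchSwinnertonDyer.BirchSwinnertonDyer.Theorems

end
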